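import Literature.MathematicalPhysics.QuantumFieldTheory.Federbush1986.PhaseCellIVThmA1Large
import Literature.MathematicalPhysics.QuantumFieldTheory.Federbush1986.PhaseCellIVGeomConstruction1
import Literature.MathematicalPhysics.QuantumFieldTheory.Federbush1986.PhaseCellIVGeomConstruction3
import Literature.Analysis.Calculus.SubmanifoldTubularRetraction

/-!
# Federbush, *A phase cell approach to Yang–Mills theory. IV. The choice of variables* (CMP **114** (1988) 317–343) —
# Theorem A.1 (every cap) and §11 Geometric Constructions 1, 2 AT PRINT'S GENERALITY under the embedded reading:
# every COMPACT (`C^∞`, embedded) SUBMANIFOLD `M ⊂ Rᵗ` — the uniform-retraction hypotheses DISCHARGED by the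
# tubular-neighbourhood theorem (`Literature.Analysis.Calculus.SubmanifoldTubularRetraction`, p299101)

statement-level skeleton of published theorems with citation tags; proofs where landed; nothing here is a claim about the Yang–Mills mass gap

Cell `lit-balaban`, reader/typer block **r19** (F4 fold owner), SKELETON rows `F4.ThmA.1`, `F4.Eq11.4` of
`run/shared/lean/pub/lit-balaban/lit-balaban-r19/ROWS-F4.md`; sibling of p04's `PhaseCellIVThmA34Submanifold` (Theorems A.3, A.4,
A.2, A.1 small clause, Construction 4 for compact submanifolds), which this file completes with Theorem A.1 at every cap
(`thmA1Emb_of_retract`, p299105) and Constructions 1 (`geomConstruction1_of_retract`, p299469) and 2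
(`geomConstruction2_of_retract`, p264612).

**Source.** P. Federbush, Commun. Math. Phys. **114** (1988) 317–343 [bib `Federbush1988PhaseCellIV`; doi:10.1007/bf01225039;
journal page = PDF page + 316], p. 337 [PDF 21] ((11.4)–(11.6)), p. 339 [PDF 23] (Theorem A.1: «Let `M` be a compact differentiable
manifold (without boundary) and provided with a Riemannian metric»), p. 342 [PDF 26] («We now embed `M` in some Euclidean space
`Rᵗ` … Let `Pr_M` be the normal projection onto `M`, defined in a neighborhood of `M` in `Rᵗ`»).  Renders
`lit-balaban-r19/renders/f4/f4-p021.png`, `-p023.png`, `-p026.png`.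

**What this file proves.** For `M ⊆ EuclideanSpace ℝ (Fin t)` compact with `IsSubmanifoldOfDim d (EuclideanSpace.equiv '' M)`
(the tree's vocabulary for an embedded `d`-dimensional `C^∞` submanifold, as in p04's files):
* `thmA1Emb_of_submanifold (n) : ThmA1Emb n t M` — Theorem A.1 at every cap `c₁`, every cube dimension;
* `geomConstruction1_of_submanifold : IsPreconnected M → GeomConstruction1 t M` — (11.4) (connectedness is needed for the
  statement as typed: end values in different components cannot be joined inside `M`);
* `geomConstruction2_of_submanifold : GeomConstruction2 t M` — (11.5)–(11.6).
Each is the corresponding `_of_retract` theorem fed with `exists_smooth_retraction_euclidean` (p299101: a compact `C^∞`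
submanifold of `ℝᵗ` has `r > 0` and a smooth nearest-point retraction `P`, Lipschitz on `{dist(·, M) < r}`, with values in `M`
there and `P = id` on `M` — print's `Pr_M`); the empty `M` is handled separately (the statements are then vacuous).
* (v1.1, APPEND-ONLY) `geomConstruction3_of_submanifold (k) : GeomConstruction3 k t M` — Construction 3 (11.7)–(11.8) at every
  scale (`PhaseCellIVGeomConstruction3`, p299713) for every compact `C^∞` submanifold, and the four-statement bundle
  `thmA1Emb_and_geomConstructions123_of_submanifold`.
-/

namespace Literature.MathematicalPhysics.QuantumFieldTheory.Federbush1986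

noncomputable section

open scoped NNReal ENNReal
open Set Metric

namespace PhaseCellIVAppA

open Literature.AlgebraicGeometry.RealAlgebraic Literature.Analysis.Calculus

variable {t d : ℕ}

/-- **Theorem A.1 of [Federbush1988PhaseCellIV] (embedded reading, EVERY cap `c₁`) for every compact `C^∞` submanifold
`M ⊂ Rᵗ`**: «For each constant `c₁`, there is a constant `c₂ = c₂(c₁)`, such that if `f` is any homotopically trivial mapping
from `∂D` into `M` satisfying `Λ₁(f) ≤ c₁` (A.1) there is an extension of `f`, `f^e`, mapping `D` into `M`, satisfying
`Λ₁(f^e) ≤ c₂Λ₁(f)` (A.2)» — `thmA1Emb_of_retract` (p299105) with the retraction supplied by the tubular-neighbourhood theorem.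
[cite: Federbush1988PhaseCellIV, Theorem A.1 (A.1)–(A.2) p. 339; p. 342 (Pr_M)] -/
theorem thmA1Emb_of_submanifold {M : Set (EuclideanSpace ℝ (Fin t))} (hMc : IsCompact M)
    (hM : IsSubmanifoldOfDim d (EuclideanSpace.equiv (Fin t) ℝ '' M)) (n : ℕ) : ThmA1Emb n t M := by
  by_cases hne : M.Nonempty
  · obtain ⟨r, hr, P, -, hPM, hPid, -, L, hPL⟩ := exists_smooth_retraction_euclidean hMc hne hM
    exact thmA1Emb_of_retract hMc hr hPL (fun y hy => hPM y hy) hPid n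
  · intro c₁
    refine ⟨0, fun f hf _ => ?_⟩
    obtain ⟨y, -⟩ := hf
    exact absurd ⟨_, y.2⟩ hne

/-- `U(1)`, `SU(2)` already: see `thmA1Emb_sphere` (p299105).  **Geometric Construction 1, (11.4) p. 337, for every compact
CONNECTED `C^∞` submanifold `M ⊂ Rᵗ`**: «ᵉφ′₁(v_a) and ᵉφ′₁(v_b) assume given values … `Λ₁(ᵉφ′₁) ≤ c · d(φ′₁(v_b), φ′₁(v_a))/L_r`»
— `geomConstruction1_of_retract` (p299469) with the tubular retraction. [cite: Federbush1988PhaseCellIV, Geometric Construction 1 (11.4) p. 337; p. 342 (Pr_M)] -/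
theorem geomConstruction1_of_submanifold {M : Set (EuclideanSpace ℝ (Fin t))} (hMc : IsCompact M) (hconn : IsPreconnected M)
    (hM : IsSubmanifoldOfDim d (EuclideanSpace.equiv (Fin t) ℝ '' M)) : GeomConstruction1 t M := by
  by_cases hne : M.Nonempty
  · obtain ⟨r, hr, P, -, hPM, hPid, -, L, hPL⟩ := exists_smooth_retraction_euclidean hMc hne hM
    exact geomConstruction1_of_retract hMc hconn hr hPL (fun y hy => hPM y hy) hPid
  · exact ⟨0, fun ℓ _ ga _ => absurd ⟨_, ga.2⟩ hne⟩

/-- **Geometric Construction 2, (11.5)–(11.6) p. 337, for every compact `C^∞` submanifold `M ⊂ Rᵗ`**: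
«`d^g(ᵉφ₁, ᵉφ₂) ≤ c d^g(φ₁, φ₂)` (11.5), `Λ₁(ᵉφ₂) ≤ c(Λ₁(ᵉφ₁) + d^g(φ₁, φ₂)/L_r + Λ₁(φ₂))` (11.6)» — `geomConstruction2_of_retract`
(p264612) with the tubular retraction. [cite: Federbush1988PhaseCellIV, Geometric Construction 2 (11.5)–(11.6) p. 337; p. 342 (Pr_M)] -/
theorem geomConstruction2_of_submanifold {M : Set (EuclideanSpace ℝ (Fin t))} (hMc : IsCompact M)
    (hM : IsSubmanifoldOfDim d (EuclideanSpace.equiv (Fin t) ℝ '' M)) : GeomConstruction2 t M := by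
  by_cases hne : M.Nonempty
  · obtain ⟨r, hr, P, -, hPM, hPid, -, L, hPL⟩ := exists_smooth_retraction_euclidean hMc hne hM
    exact geomConstruction2_of_retract hr hPL (fun y hy => hPM y hy) hPid
  · refine ⟨1, one_pos, 1, fun ℓ hℓ φ₁ _ eφ₁ _ _ => ?_⟩
    exact absurd ⟨_, (eφ₁ ⟨0, mem_closedBall_self (by positivity)⟩).2⟩ hne

/-- **Summary: Theorem A.1 (every cap) and Constructions 1, 2 together, for a compact connected `C^∞` submanifold `M ⊂ Rᵗ`.**
[cite: Federbush1988PhaseCellIV, Theorem A.1 p. 339; (11.4)–(11.6) p. 337] -/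
theorem thmA1Emb_and_geomConstructions_of_submanifold {M : Set (EuclideanSpace ℝ (Fin t))} (hMc : IsCompact M)
    (hconn : IsPreconnected M) (hM : IsSubmanifoldOfDim d (EuclideanSpace.equiv (Fin t) ℝ '' M)) (n : ℕ) :
    ThmA1Emb n t M ∧ GeomConstruction1 t M ∧ GeomConstruction2 t M :=
  ⟨thmA1Emb_of_submanifold hMc hM n, geomConstruction1_of_submanifold hMc hconn hM, geomConstruction2_of_submanifold hMc hM⟩


/-! ## (v1.1) Geometric Construction 3 for every compact `C^∞` submanifold -/

/-- **Geometric Construction 3, (11.7)–(11.8) p. 338 (with the p. 339 «Caution»), for every compact `C^∞` submanifold `M ⊂ Rᵗ`**,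
every cube dimension `k` and every scale: «We extend `φ′₁(x)` defined on `∂D` to `ᵉφ′₁(x)` defined on `D` … a) `ᵉφ′₁(x) = φ′₁(x)`
(11.7), b) `Λ₁(ᵉφ′₁) ≤ cΛ₁(φ′₁)` (11.8)» — `geomConstruction3_of_thmA1Emb` (p299713) applied to `thmA1Emb_of_submanifold`.
[cite: Federbush1988PhaseCellIV, Geometric Construction 3 (11.7)–(11.8) p. 338; Caution p. 339; p. 342 (Pr_M)] -/
theorem geomConstruction3_of_submanifold {M : Set (EuclideanSpace ℝ (Fin t))} (hMc : IsCompact M)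
    (hM : IsSubmanifoldOfDim d (EuclideanSpace.equiv (Fin t) ℝ '' M)) (k : ℕ) : GeomConstruction3 k t M :=
  geomConstruction3_of_thmA1Emb (thmA1Emb_of_submanifold hMc hM k)

/-- **Summary (v1.1): Theorem A.1 (every cap) and Constructions 1, 2, 3 for a compact connected `C^∞` submanifold `M ⊂ Rᵗ`**
(Construction 4 and Theorems A.2–A.4: p04's `PhaseCellIVThmA34Submanifold`).
[cite: Federbush1988PhaseCellIV, Theorem A.1 p. 339; (11.4)–(11.8) pp. 337–338] -/
theorem thmA1Emb_and_geomConstructions123_of_submanifold {M : Set (EuclideanSpace ℝ (Fin t))} (hMc : IsCompact M)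
    (hconn : IsPreconnected M) (hM : IsSubmanifoldOfDim d (EuclideanSpace.equiv (Fin t) ℝ '' M)) (n : ℕ) :
    ThmA1Emb n t M ∧ GeomConstruction1 t M ∧ GeomConstruction2 t M ∧ GeomConstruction3 n t M :=
  ⟨thmA1Emb_of_submanifold hMc hM n, geomConstruction1_of_submanifold hMc hconn hM, geomConstruction2_of_submanifold hMc hM,
    geomConstruction3_of_submanifold hMc hM n⟩

end PhaseCellIVAppA

end

end Literature.MathematicalPhysics.QuantumFieldTheory.Federbush1986
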